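import Mathlib

/-!
# Length of a vertical fibre as the sum of its band widths

Helper of the algebraic-area layer of crux `stmt-KontsevichZagierPeriods-9847`
(`PlanarK0Injective`, route SymplecticScissors, line lead seat c5).

Over a base point of a good cell of a cylindrical decomposition, the vertical fibre of a planar
region is a finite set of section values together with finitely many pairwise disjoint open
bands.  This file records the resulting formula for the Lebesgue length of the fibre: the finite
part is null and the bands contribute the sum of their widths.  Pure measure theory on `ℝ`.
-/

open MeasureTheory Set
open scoped BigOperators

namespace Summit.KontsevichZagierPeriods.SymplecticScissors.PlanarK0InjectiveAlgebraicLayer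

/-- **Fibre length formula.**  If `A ⊆ ℝ` is the union of a finite set of points `{pt i : i ∈ G}`
and of finitely many pairwise disjoint open intervals `(lo j, hi j)`, `j ∈ T`, with `lo j < hi j`,
then the Lebesgue measure of `A` is `∑ j ∈ T, (hi j - lo j)`. [folklore] -/
theorem volume_toReal_eq_sum_of_eq_union {ι κ : Type*} (G : Finset ι) (T : Finset κ)
    (pt : ι → ℝ) (lo hi : κ → ℝ) (hlt : ∀ j ∈ T, lo j < hi j)
    (hdisj : (T : Set κ).PairwiseDisjoint fun j => Ioo (lo j) (hi j)) {A : Set ℝ}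
    (hA : A = (⋃ i ∈ G, {pt i}) ∪ ⋃ j ∈ T, Ioo (lo j) (hi j)) :
    (volume A).toReal = ∑ j ∈ T, (hi j - lo j) := by
  subst hA
  -- the finite part is Lebesgue-null
  have hN : volume (⋃ i ∈ G, ({pt i} : Set ℝ)) = 0 :=
    (G.finite_toSet.biUnion fun i _ => finite_singleton (pt i)).measure_zero volume
  -- hence it can be dropped from the union
  have hU : volume ((⋃ i ∈ G, ({pt i} : Set ℝ)) ∪ ⋃ j ∈ T, Ioo (lo j) (hi j)) =
      volume (⋃ j ∈ T, Ioo (lo j) (hi j)) :=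
    measure_congr (union_ae_eq_right_of_ae_eq_empty (ae_eq_empty.mpr hN))
  -- the bands are disjoint measurable sets, so their measures add up
  rw [hU, measure_biUnion_finset hdisj fun j _ => measurableSet_Ioo,
    ENNReal.toReal_sum fun j _ => by rw [Real.volume_Ioo]; exact ENNReal.ofReal_ne_top]
  refine Finset.sum_congr rfl fun j hj => ?_
  rw [Real.volume_Ioo, ENNReal.toReal_ofReal (sub_nonneg.2 (hlt j hj).le)]

/-! ## Registered anchor -/

/-- Registered anchor of this helper file (crux protocol `--supports`): the fibre length formula
`volume_toReal_eq_sum_of_eq_union` in binder-free form. [folklore] -/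
theorem helper_algebraicLayer_fibre :
    ∀ {ι κ : Type*} (G : Finset ι) (T : Finset κ) (pt : ι → ℝ) (lo hi : κ → ℝ),
      (∀ j ∈ T, lo j < hi j) → (T : Set κ).PairwiseDisjoint (fun j => Set.Ioo (lo j) (hi j)) →
      ∀ (A : Set ℝ), (A = (⋃ i ∈ G, {pt i}) ∪ ⋃ j ∈ T, Set.Ioo (lo j) (hi j)) →
      (MeasureTheory.volume A).toReal = ∑ j ∈ T, (hi j - lo j) :=
  fun G T pt lo hi hlt hdisj _ hA => volume_toReal_eq_sum_of_eq_union G T pt lo hi hlt hdisj hA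

end Summit.KontsevichZagierPeriods.SymplecticScissors.PlanarK0InjectiveAlgebraicLayer
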